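/-
Copyright (c) 2026 the pub-hodgecm-mathlib formalisation cell (harness21).  Prover seat hodgecm-mathlib-K2Liu-p10 (g4), Track B «K2-LIT»,
#184♮ = hLiu418 = `stmt-HodgeConjecture-24832`; (σ) endgame organ, (L3-b): the Siegel characters on integral Levi points and at a non-unit.  KERNEL: theorems only.
-/
import Literature.NumberTheory.K2Lit.DoubledUnitaryDegeneratePrincipalSeries   -- ★ `localSiegelCharacter`, `chiDet`, `absDetDelta`, `detDelta`
import Literature.NumberTheory.GelbartRogawski1991.LocalDoubledUnitaryBetaUnitary  -- ★ `norm_chiDet_eq_one`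
import Mathlib.Analysis.SpecialFunctions.Pow.Complex
import Mathlib.Analysis.SpecialFunctions.Pow.Real
import HarnessLib

/-!
# Crux `HLiu418`, (σ) endgame, (L3-b): `χ_v(det_Δ p)|det_Δ p|^{s+n/2}` IS `1` ON `det_Δ`-UNITS FOR UNRAMIFIED `χ_v`, AND THE `s = ±1/2` CHARACTERS DIFFER WHERE `|det_Δ| ≠ 1`

Cell `hodgecm-mathlib`, crux item hLiu418 = `stmt-HodgeConjecture-24832`, route of record `HCCMUnconditional`; squad K2 ∕ K2Liu, prover K2Liu-p10 (g4).
THEOREMS ONLY; lane `--supports stmt-HodgeConjecture-24832 --as helper`.  Currency of ★ K2Lit `DoubledUnitaryDegeneratePrincipalSeries` (`F E c v n JD χv`).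

With ★ (L3-a) `coe_cM_eq_localSiegelCharacter` (`cM = localSiegelCharacter χv (1/2) ∘ mΔ`), V8e's two remaining Levi letters `hK₁χ` ∕ `ha₀` are statements about the Siegel
characters alone; this file supplies them in the form the instance at a GOOD place uses (`χ_v`, `χ′_v` unramified; `K₁ ⊆ M_Δ` integral so that every `det_Δ,w` is a unit):
* §1 **`localSiegelCharacter_eq_one_of_norm_detDelta_eq_one`**: if `χ_w(u) = 1` for all `u` of norm `1` and `‖det_Δ,w p‖ = 1` for all `w ∣ v`, then `localSiegelCharacter χv s p = 1`
  (any `s`); hence **`localSiegelCharacter_eq_of_norm_detDelta_eq_one`**: the `(χv, s)` and `(χv′, s′)` characters AGREE there (= the `hshift` of ★ `hK₁χ_of_shift`).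
* §2 **`localSiegelCharacter_half_ne_neg_half`**: if all `χ_w`, `χ′_w` take values of modulus `1` and `0 < |det_Δ p|_v ≠ 1`, then
  `localSiegelCharacter χv (1/2) p ≠ localSiegelCharacter χv′ (−1/2) p` (their moduli are `|det_Δ p|^{(n+1)/2} ≠ |det_Δ p|^{(n−1)/2}`) (= the `hne` of ★ `ha₀_of_shift_ne`).

HONEST LABEL: HC_CM is proved only modulo the 7 printed citations (2 remaining named inputs: hLiu418 = stmt-HodgeConjecture-24832, h413 = stmt-HodgeConjecture-24833)
until rung 0 closes; helper, closes no item.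
References: [HarrisKudlaSweet1996] M. Harris, S. Kudla, W. J. Sweet, JAMS 9 (1996) §1 (1.15)–(1.16); [Kudla1994] §3; [Liu2021] App. B §B.3.
-/

set_option autoImplicit false
set_option linter.dupNamespace false -- the mandated namespace repeats `HodgeConjecture.HodgeConjecture`

noncomputable section

open scoped Matrix
open NumberField IsDedekindDomain
open Literature.NumberTheory.Automorphic Literature.NumberTheory.Automorphic.UnitaryGroup
open Literature.NumberTheory.GelbartRogawski1991.UnitaryDualPair.LocalSplitting
open Literature.NumberTheory.K2Lit.LocalSiegelDoubled

namespace Summit.HodgeConjecture.HodgeConjecture.Cruxes.HLiu418.K2LiuSiegelCharacterUnramifiedShift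

variable (F : Type) [Field F] [NumberField F] (E : Type) [Field E] [NumberField E] [Algebra F E]
  (c : E ≃ₐ[F] E) (v : HeightOneSpectrum (𝓞 F)) (n : ℕ)
  {JD : Matrix (Fin (n + n)) (Fin (n + n)) E}

/-! ## §1 Integral Levi points: the character is `1` -/

/-- on `det_Δ`-units an unramified family gives `χ_v(det_Δ p) = 1`. [cite: HarrisKudlaSweet1996, §1 (1.15)] -/
theorem chiDet_eq_one_of_norm_detDelta_eq_one (χv : ∀ w : PlacesOver E v, (w.1.adicCompletion E)ˣ →* ℂˣ)
    (hχ : ∀ (w : PlacesOver E v) (u : (w.1.adicCompletion E)ˣ), ‖(u : w.1.adicCompletion E)‖ = 1 → χv w u = 1)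
    (p : UnitaryGroup.localPi E c (n + n) JD v) (hp : ∀ w : PlacesOver E v, ‖detDelta F E c v n w p‖ = 1) :
    chiDet F E c v n χv p = 1 := by
  classical
  unfold chiDet
  refine Finset.prod_eq_one fun w _ => ?_
  have hne : detDelta F E c v n w p ≠ 0 := fun h => by simpa [h] using hp w
  rw [dif_pos (isUnit_iff_ne_zero.2 hne)]
  exact hχ w _ (by rw [IsUnit.unit_spec]; exact hp w)

/-- on `det_Δ`-units `|det_Δ p|_v = 1`. [cite: HarrisKudlaSweet1996, §1 (1.15)] -/
theorem absDetDelta_eq_one_of_norm_detDelta_eq_one (p : UnitaryGroup.localPi E c (n + n) JD v)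
    (hp : ∀ w : PlacesOver E v, ‖detDelta F E c v n w p‖ = 1) : absDetDelta F E c v n p = 1 := by
  unfold absDetDelta
  exact Finset.prod_eq_one fun w _ => hp w

/-- **`localSiegelCharacter χv s p = 1` ON INTEGRAL LEVI POINTS** (`χ_v` unramified, every `det_Δ,w p` a unit), for every `s`.
[cite: HarrisKudlaSweet1996, §1 (1.15)] [cite: Kudla1994, §3] -/
theorem localSiegelCharacter_eq_one_of_norm_detDelta_eq_one (χv : ∀ w : PlacesOver E v, (w.1.adicCompletion E)ˣ →* ℂˣ) (s : ℂ)
    (hχ : ∀ (w : PlacesOver E v) (u : (w.1.adicCompletion E)ˣ), ‖(u : w.1.adicCompletion E)‖ = 1 → χv w u = 1)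
    (p : UnitaryGroup.localPi E c (n + n) JD v) (hp : ∀ w : PlacesOver E v, ‖detDelta F E c v n w p‖ = 1) :
    localSiegelCharacter F E c v n χv s p = 1 := by
  unfold localSiegelCharacter
  rw [chiDet_eq_one_of_norm_detDelta_eq_one F E c v n χv hχ p hp, absDetDelta_eq_one_of_norm_detDelta_eq_one F E c v n p hp, Units.val_one,
    Complex.ofReal_one, Complex.one_cpow, one_mul]

/-- **THE CHARACTER COMPARISON ON INTEGRAL LEVI POINTS** (the `hshift` of ★ (L3-a) `hK₁χ_of_shift`): for unramified `χ_v`, `χ′_v` and a subgroup `K₁` whose images have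
unit `det_Δ,w`, the `(χv, s)`- and `(χv′, s′)`-Siegel characters agree on `mΔ(K₁)`. [cite: HarrisKudlaSweet1996, §1 (1.15)] -/
theorem localSiegelCharacter_eq_of_norm_detDelta_eq_one (χv χv' : ∀ w : PlacesOver E v, (w.1.adicCompletion E)ˣ →* ℂˣ) (s s' : ℂ)
    (hχ : ∀ (w : PlacesOver E v) (u : (w.1.adicCompletion E)ˣ), ‖(u : w.1.adicCompletion E)‖ = 1 → χv w u = 1)
    (hχ' : ∀ (w : PlacesOver E v) (u : (w.1.adicCompletion E)ˣ), ‖(u : w.1.adicCompletion E)‖ = 1 → χv' w u = 1)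
    {Γ₁ : Type} [Group Γ₁] (mΔ : Γ₁ →* UnitaryGroup.localPi E c (n + n) JD v) (K₁ : Subgroup Γ₁)
    (hK₁ : ∀ a ∈ K₁, ∀ w : PlacesOver E v, ‖detDelta F E c v n w (mΔ a)‖ = 1) :
    ∀ a ∈ K₁, localSiegelCharacter F E c v n χv s (mΔ a) = localSiegelCharacter F E c v n χv' s' (mΔ a) := fun a ha => by
  rw [localSiegelCharacter_eq_one_of_norm_detDelta_eq_one F E c v n χv s hχ _ (hK₁ a ha), localSiegelCharacter_eq_one_of_norm_detDelta_eq_one F E c v n χv' s' hχ' _ (hK₁ a ha)]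

/-! ## §2 A non-unit: the `s = ½` and `s = −½` characters differ -/

/-- the modulus of the Siegel character: `|det_Δ p|_v^{re s + n/2}` (unitary `χ_v`, `|det_Δ p|_v > 0`). [cite: HarrisKudlaSweet1996, §1 (1.15)] -/
theorem norm_localSiegelCharacter (χv : ∀ w : PlacesOver E v, (w.1.adicCompletion E)ˣ →* ℂˣ)
    (hχu : ∀ (w : PlacesOver E v) (u : (w.1.adicCompletion E)ˣ), ‖((χv w u : ℂˣ) : ℂ)‖ = 1) (s : ℂ) (p : UnitaryGroup.localPi E c (n + n) JD v)
    (hpos : 0 < absDetDelta F E c v n p) :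
    ‖localSiegelCharacter F E c v n χv s p‖ = absDetDelta F E c v n p ^ (s + (n : ℂ) / 2).re := by
  unfold localSiegelCharacter
  rw [norm_mul, norm_chiDet_eq_one F E c v n χv hχu p, one_mul, Complex.norm_cpow_eq_rpow_re_of_pos hpos]

/-- **AT A NON-UNIT THE `s = ½` AND `s = −½` CHARACTERS DIFFER** (the `hne` of ★ (L3-a) `ha₀_of_shift_ne`): unitary `χ_v`, `χ′_v`, `0 < |det_Δ p|_v ≠ 1`.
[cite: HarrisKudlaSweet1996, §1 (1.15)–(1.16)] -/
theorem localSiegelCharacter_half_ne_neg_half (χv χv' : ∀ w : PlacesOver E v, (w.1.adicCompletion E)ˣ →* ℂˣ)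
    (hχu : ∀ (w : PlacesOver E v) (u : (w.1.adicCompletion E)ˣ), ‖((χv w u : ℂˣ) : ℂ)‖ = 1)
    (hχu' : ∀ (w : PlacesOver E v) (u : (w.1.adicCompletion E)ˣ), ‖((χv' w u : ℂˣ) : ℂ)‖ = 1)
    (p : UnitaryGroup.localPi E c (n + n) JD v) (hpos : 0 < absDetDelta F E c v n p) (hne : absDetDelta F E c v n p ≠ 1) :
    localSiegelCharacter F E c v n χv (1 / 2) p ≠ localSiegelCharacter F E c v n χv' (-(1 / 2)) p := by
  intro h
  have hn : ‖localSiegelCharacter F E c v n χv (1 / 2) p‖ = ‖localSiegelCharacter F E c v n χv' (-(1 / 2)) p‖ := congrArg Norm.norm h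
  rw [norm_localSiegelCharacter F E c v n χv hχu _ p hpos, norm_localSiegelCharacter F E c v n χv' hχu' _ p hpos] at hn
  have h1 : ((1 : ℂ) / 2 + (n : ℂ) / 2).re = 1 / 2 + (n : ℝ) / 2 := by simp
  have h2 : (-((1 : ℂ) / 2) + (n : ℂ) / 2).re = -(1 / 2) + (n : ℝ) / 2 := by simp
  rw [h1, h2] at hn
  -- `r^{a} = r^{b}` with `b < a`, `0 < r ≠ 1` is impossible
  have hba : -((1 : ℝ) / 2) + (n : ℝ) / 2 < 1 / 2 + (n : ℝ) / 2 := by linarith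
  rcases lt_or_gt_of_ne hne with hlt | hgt
  · exact absurd hn (ne_of_lt (Real.rpow_lt_rpow_of_exponent_gt hpos hlt hba))
  · exact absurd hn.symm (ne_of_lt (Real.rpow_lt_rpow_of_exponent_lt hgt hba))

end Summit.HodgeConjecture.HodgeConjecture.Cruxes.HLiu418.K2LiuSiegelCharacterUnramifiedShift

end
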